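import Mathlib
import Summits.KontsevichZagierPeriods.Zeta5Search.QPencilDInterface
import Summits.KontsevichZagierPeriods.Zeta5Search.CellPencilWide
import Summits.KontsevichZagierPeriods.Zeta5Search.WedgeDictionaryWideConsequences
import Summits.KontsevichZagierPeriods.Zeta5Search.WedgeDictionaryTerminalDescent
import HarnessLib

/-!
# Brown–Zudilin's decomposition (4) with (17) on the WHOLE convergence cone (cell `pub-zeta5`, ct-1 g24)

HONEST FRAMING: systematic search; no irrationality claim unless certified.  Identities among Brown–Zudilin's absolutely
convergent cellular integrals `I(a)` (arXiv:2210.03391, (1)), their leading coefficient `Q(a)` of (17) (`QOf`) and the cell's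
rational dictionary data; the only «values» are the shapes `ℚ·(2ζ(5)+4ζ(3)ζ(2)) + ℚ·ζ(2) + ℚ` the relations force.  Brown–Zudilin's
(4) is a DECOMPOSITION, not an irrationality statement: nothing here is about `ζ(5)`'s irrationality; no bound on any linear
form, no `γ`; records in print UNMOVED.

OUR work (Summit side; seat `pub-zeta5-ct-1` generation 24, 2026-08-26).  The named Literature fact
`BrownZudilin2022.decomposition` — for EVERY convergent `a` there are `P̂, P ∈ ℚ` with
`I(a) = Q(a)·(2ζ(5) + 4ζ(3)ζ(2)) − 4P̂·ζ(2) − 2P` — is DISCHARGED: **`decomposition_holds`**.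

* On the WIDE region (`b(a) ≥ 0`, `d(b(a)) ≥ 0`) this is ct-1 g23's `decomposition_on_wide_region` (from `wedgeDictionaryFull_holds`).
* Off it, `Q(a) = 0` (ct-1 g24's `QOf_eq_zero_of_slot_neg` / `QOf_eq_zero_of_dOf_neg`) and the shape is reached by two nested
  inductions (on `−d` for points with `b ≥ 0`, then on the depth `max_j (−b_j)` of the most negative slot) along gen-1's slot
  PENCIL, whose cellular side holds at every convergent configuration (ct-1 g24's `cellPencil_wide_2/7/1`) and whose `Q`-side is
  supplied case by case:
  - some slot `b_m < 0` (then `d ≥ 1`): `a` is the BASE of the slot-2 pencil `{a, a + DS, a + DS − s₂}`; if some slot is `≤ −2`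
    all three `Q` vanish, otherwise `a + DS` is wide and the `Q`-relation is ct-1 g24's `dictPencil_Q_of_ghost_base`;
  - `b ≥ 0`, `d < 0` (then every slot is `≥ 1`): `a` is the APEX of the pencil based at `a − DS` in a slot `i ∈ {2, 7, 1}`;
    if `d ≤ −2` all three `Q` vanish; if `d = −1` the `Q`-relation is ct-1 g24's `dictPencil_Q_dZero` in a slot with `b_i ≥ 2`,
    and the one point with `b₁ = b₂ = b₇ = 1`, `d = −1` is `a = DS = (0,1,0,1,0,0,0,0)` itself, settled by the slot-2 pencil
    based at `0` with its `Q`-side evaluated by `decide`.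
  In each step the two other members converge and are smaller in the relevant induction, and a three-term relation holding for
  `I` AND for `Q` transfers the shape (`shape_of_threeTerm_first/second`).
Exact rehearsal before formalisation (seat folder `code/scheme5.py`): the `Q`-side of every step at all 34 919 non-wide convergent
dual points of the box `{0,…,4}⁸` (17 298 ghost-base, 17 151 trivial, 370 `d`-interface, 99 trivial apex, 1 special), 0 failures.
-/

noncomputable section

open Finset

namespace Summit.KontsevichZagierPeriods.Zeta5Search.DecompositionWholeCone

open Summit.KontsevichZagierPeriods.Zeta5Search.WedgeDictionary
open Summit.KontsevichZagierPeriods.Zeta5Search.Elimination (dictPencil_Q_of_ghost_base bOfA_dsUp_slot bOfA_dsUp_zero)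
open Summit.KontsevichZagierPeriods.Zeta5Search.CellPencilWide (cellPencil_wide_2 cellPencil_wide_7 cellPencil_wide_1)
open Summit.KontsevichZagierPeriods.Zeta5Search.WedgeDictionaryWideConsequences (decomposition_on_wide_region)
open Summit.KontsevichZagierPeriods.Zeta5Search.WedgeDictionaryWideSteps (converges_iff_bcoords)
open Literature.NumberTheory.Irrationality.BrownZudilin2022 (bOfA Converges QOf cellularIntegral decomposition)
open Literature.NumberTheory.Transcendental (zetaValue)

/-! ### 1. A three-term relation holding for `I` and for `Q` transfers the shape (4) -/

/-- If `α·I(x) + β·I(y) + γ·I(z) = 0` with `α ≠ 0`, the same relation holds for `Q`, and `I(y)`, `I(z)` have Brown–Zudilin's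
shape (4), then so does `I(x)` (with `P̂(x) = −(βP̂(y) + γP̂(z))/α`, `P(x) = −(βP(y) + γP(z))/α`). [folklore] -/
theorem shape_of_threeTerm_first {α β γ : ℚ} {x y z : Fin 8 → ℤ} (hα : α ≠ 0) (hI : ThreeTermRel α β γ x y z)
    (hQ : α * (QOf x : ℚ) + β * (QOf y : ℚ) + γ * (QOf z : ℚ) = 0)
    (hy : ∃ Phat P : ℚ, cellularIntegral y =
      (QOf y : ℝ) * (2 * zetaValue 5 + 4 * zetaValue 3 * zetaValue 2) - 4 * (Phat : ℝ) * zetaValue 2 - 2 * (P : ℝ))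
    (hz : ∃ Phat P : ℚ, cellularIntegral z =
      (QOf z : ℝ) * (2 * zetaValue 5 + 4 * zetaValue 3 * zetaValue 2) - 4 * (Phat : ℝ) * zetaValue 2 - 2 * (P : ℝ)) :
    ∃ Phat P : ℚ, cellularIntegral x =
      (QOf x : ℝ) * (2 * zetaValue 5 + 4 * zetaValue 3 * zetaValue 2) - 4 * (Phat : ℝ) * zetaValue 2 - 2 * (P : ℝ) := by
  obtain ⟨Py', Py, hy⟩ := hy
  obtain ⟨Pz', Pz, hz⟩ := hz
  refine ⟨-(β * Py' + γ * Pz') / α, -(β * Py + γ * Pz) / α, ?_⟩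
  unfold ThreeTermRel at hI
  have hα' : (α : ℝ) ≠ 0 := by exact_mod_cast hα
  have hQ' : (α : ℝ) * (QOf x : ℝ) + (β : ℝ) * (QOf y : ℝ) + (γ : ℝ) * (QOf z : ℝ) = 0 := by exact_mod_cast hQ
  rw [hy, hz] at hI
  have e1 : cellularIntegral x = (α : ℝ)⁻¹ *
      (-((β : ℝ) * ((QOf y : ℝ) * (2 * zetaValue 5 + 4 * zetaValue 3 * zetaValue 2) - 4 * (Py' : ℝ) * zetaValue 2 - 2 * (Py : ℝ)) +
        (γ : ℝ) * ((QOf z : ℝ) * (2 * zetaValue 5 + 4 * zetaValue 3 * zetaValue 2) - 4 * (Pz' : ℝ) * zetaValue 2 - 2 * (Pz : ℝ)))) := by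
    rw [eq_inv_mul_iff_mul_eq₀ hα']
    linear_combination hI
  have e2 : (QOf x : ℝ) = (α : ℝ)⁻¹ * (-((β : ℝ) * (QOf y : ℝ) + (γ : ℝ) * (QOf z : ℝ))) := by
    rw [eq_inv_mul_iff_mul_eq₀ hα']
    linear_combination hQ'
  rw [e1, e2]
  push_cast
  ring

/-- The same, solved for the SECOND member (`β ≠ 0`). [folklore] -/
theorem shape_of_threeTerm_second {α β γ : ℚ} {x y z : Fin 8 → ℤ} (hβ : β ≠ 0) (hI : ThreeTermRel α β γ x y z)
    (hQ : α * (QOf x : ℚ) + β * (QOf y : ℚ) + γ * (QOf z : ℚ) = 0)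
    (hx : ∃ Phat P : ℚ, cellularIntegral x =
      (QOf x : ℝ) * (2 * zetaValue 5 + 4 * zetaValue 3 * zetaValue 2) - 4 * (Phat : ℝ) * zetaValue 2 - 2 * (P : ℝ))
    (hz : ∃ Phat P : ℚ, cellularIntegral z =
      (QOf z : ℝ) * (2 * zetaValue 5 + 4 * zetaValue 3 * zetaValue 2) - 4 * (Phat : ℝ) * zetaValue 2 - 2 * (P : ℝ)) :
    ∃ Phat P : ℚ, cellularIntegral y =
      (QOf y : ℝ) * (2 * zetaValue 5 + 4 * zetaValue 3 * zetaValue 2) - 4 * (Phat : ℝ) * zetaValue 2 - 2 * (P : ℝ) := by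
  have hI' : ThreeTermRel β α γ y x z := by unfold ThreeTermRel at hI ⊢; linear_combination hI
  exact shape_of_threeTerm_first hβ hI' (by linear_combination hQ) hx hz

/-! ### 2. Bookkeeping: `d` spelled out; the special point -/

/-- `d(b) = 3b₀ − (b₁ + ⋯ + b₇)`. -/
theorem dOf_expand (b : ℕ → ℤ) : dOf b = 3 * b 0 - (b 1 + b 2 + b 3 + b 4 + b 5 + b 6 + b 7) := by
  simp only [dOf, sum_range_succ, sum_range_zero]
  ring

/-- **The special point `a = DS = (0,1,0,1,0,0,0,0)`** (`b = (2;1,…,1)`, `d = −1`): `I(DS)` has the shape (4), by the slot-2 PENCIL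
based at `0` — members `0` and `DS − s₂` are wide, and the `Q`-side `−1·Q(0) + 2·Q(DS) + 1·Q(DS − s₂) = −1 + 0 + 1 = 0` is a
computation (`decide`). -/
theorem shape_dsUp : ∃ Phat P : ℚ, cellularIntegral dsUp =
    (QOf dsUp : ℝ) * (2 * zetaValue 5 + 4 * zetaValue 3 * zetaValue 2) - 4 * (Phat : ℝ) * zetaValue 2 - 2 * (P : ℝ) := by
  have hconv0 : Converges (0 : Fin 8 → ℤ) := by rw [converges_iff_bcoords]; decide
  have hconv1 : Converges ((0 : Fin 8 → ℤ) + dsUp) := converges_dsUp hconv0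
  have hconv2 : Converges ((0 : Fin 8 → ℤ) + dsUp + slotDown 2) := converges_dsUp_slotDown hconv0 (by simp)
  have hI := cellPencil_wide_2 0 hconv0 hconv1 hconv2
  rw [zero_add] at hI hconv2
  have e1 : pencilApex (bOfA 0) 2 = 2 := by decide
  have hQ : (pencilBase (bOfA 0) : ℚ) * (QOf 0 : ℚ) + (pencilApex (bOfA 0) 2 : ℚ) * (QOf dsUp : ℚ) +
      (fanCoeff (bOfA dsUp) 2 : ℚ) * (QOf (dsUp + slotDown 2) : ℚ) = 0 := by
    have e0 : pencilBase (bOfA 0) = -1 := by decide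
    have e2 : QOf 0 = 1 := by decide
    have e3 : QOf dsUp = 0 := by decide
    have e4 : fanCoeff (bOfA dsUp) 2 = 1 := by decide
    have e5 : QOf (dsUp + slotDown 2) = 1 := by decide
    rw [e0, e1, e2, e3, e4, e5]
    push_cast
    ring
  have hβ : (pencilApex (bOfA 0) 2 : ℚ) ≠ 0 := by rw [e1]; norm_num
  refine shape_of_threeTerm_second hβ hI hQ (decomposition_on_wide_region 0 hconv0 (by decide) (by decide))
    (decomposition_on_wide_region _ hconv2 (by decide) (by decide))

/-! ### 3. The two inductions -/

set_option maxHeartbeats 800000 in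
/-- **Points with `b ≥ 0`, by induction on `−d`.**  For a convergent `a` with every dual slot `≥ 0` and `d(b(a)) ≥ −k`, `I(a)` has
the shape (4): `d ≥ 0` is the wide region; for `d < 0` every slot is `≥ 1` and `a` is the APEX of the PENCIL based at `a − DS`
in a slot `i ∈ {2, 7, 1}` (members `a − DS`, `a − s_i`: slots `≥ 0`, `d + 1`), with the `Q`-side trivial for `d ≤ −2`, ct-1 g24's
`dictPencil_Q_dZero` for `d = −1` and `b_i ≥ 2`, and the special point `a = DS` when `b₁ = b₂ = b₇ = 1`. -/
theorem shape_of_nonneg_slots (k : ℕ) : ∀ a : Fin 8 → ℤ, Converges a → (∀ j ∈ Icc 1 7, 0 ≤ bOfA a j) →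
    -(k : ℤ) ≤ dOf (bOfA a) →
      ∃ Phat P : ℚ, cellularIntegral a =
        (QOf a : ℝ) * (2 * zetaValue 5 + 4 * zetaValue 3 * zetaValue 2) - 4 * (Phat : ℝ) * zetaValue 2 - 2 * (P : ℝ) := by
  induction k with
  | zero =>
    intro a hconv hnn hd
    exact decomposition_on_wide_region a hconv hnn (by omega)
  | succ k ih =>
    intro a hconv hnn hdk
    by_cases hd : 0 ≤ dOf (bOfA a)
    · exact decomposition_on_wide_region a hconv hnn hd
    have hc := (converges_iff_bcoords a).1 hconv
    have hdx := dOf_expand (bOfA a)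
    have g1 := hnn 1 (by simp); have g2 := hnn 2 (by simp); have g3 := hnn 3 (by simp); have g4 := hnn 4 (by simp)
    have g5 := hnn 5 (by simp); have g6 := hnn 6 (by simp); have g7 := hnn 7 (by simp)
    have hge1 : ∀ j ∈ Icc 1 7, 1 ≤ bOfA a j := fun j hj => by
      obtain ⟨hj1, hj7⟩ := mem_Icc.1 hj
      interval_cases j <;> omega
    -- the base `x = a − DS`: slots `b_j − 1 ≥ 0`, `d + 1`
    have ex := bOfA_sub_dsUp a
    have ex0 : bOfA (a - dsUp) 0 = bOfA a 0 - 2 := by rw [ex 0 (by norm_num), if_pos rfl]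
    have exk : ∀ j ∈ Icc 1 7, bOfA (a - dsUp) j = bOfA a j - 1 := fun j hj => by
      rw [ex j (mem_Icc.1 hj).2, if_neg (by have := (mem_Icc.1 hj).1; omega)]
    have ex1 := exk 1 (by simp); have ex2 := exk 2 (by simp); have ex3 := exk 3 (by simp); have ex4 := exk 4 (by simp)
    have ex5 := exk 5 (by simp); have ex6 := exk 6 (by simp); have ex7 := exk 7 (by simp)
    have hdxs := dOf_bOfA_sub_dsUp a
    have hconvx : Converges (a - dsUp) := by
      rw [converges_iff_bcoords, ex0, ex1, ex2, ex3, ex4, ex5, ex6, ex7]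
      omega
    have hnnx : ∀ j ∈ Icc 1 7, 0 ≤ bOfA (a - dsUp) j := fun j hj => by rw [exk j hj]; have := hge1 j hj; omega
    have hxa : a - dsUp + dsUp = a := sub_add_cancel a dsUp
    -- the step, for a slot `i ∈ {2, 7, 1}` with `b_i ≥ 2` unless `d ≤ −2`
    have main : ∀ i : ℕ, (i = 2 ∨ i = 7 ∨ i = 1) → (dOf (bOfA a) = -1 → 2 ≤ bOfA a i) →
        ∃ Phat P : ℚ, cellularIntegral a =
          (QOf a : ℝ) * (2 * zetaValue 5 + 4 * zetaValue 3 * zetaValue 2) - 4 * (Phat : ℝ) * zetaValue 2 - 2 * (P : ℝ) := by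
      intro i hi hbig
      have hiI : i ∈ Icc 1 7 := by rcases hi with rfl | rfl | rfl <;> simp
      have hconva : Converges (a - dsUp + dsUp) := by rw [hxa]; exact hconv
      have hconvz : Converges (a - dsUp + dsUp + slotDown i) := converges_dsUp_slotDown hconvx hiI
      have hI : ThreeTermRel (pencilBase (bOfA (a - dsUp))) (pencilApex (bOfA (a - dsUp)) i)
          (fanCoeff (bOfA (a - dsUp + dsUp)) i) (a - dsUp) (a - dsUp + dsUp) (a - dsUp + dsUp + slotDown i) := by
        rcases hi with rfl | rfl | rfl
        · exact cellPencil_wide_2 _ hconvx hconva hconvz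
        · exact cellPencil_wide_7 _ hconvx hconva hconvz
        · exact cellPencil_wide_1 _ hconvx hconva hconvz
      have hQ : (pencilBase (bOfA (a - dsUp)) : ℚ) * (QOf (a - dsUp) : ℚ) +
          (pencilApex (bOfA (a - dsUp)) i : ℚ) * (QOf (a - dsUp + dsUp) : ℚ) +
          (fanCoeff (bOfA (a - dsUp + dsUp)) i : ℚ) * (QOf (a - dsUp + dsUp + slotDown i) : ℚ) = 0 := by
        by_cases hd2 : dOf (bOfA a) ≤ -2
        · have hQx : QOf (a - dsUp) = 0 := QOf_eq_zero_of_dOf_neg _ (by rw [hdxs]; omega)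
          have hQa : QOf (a - dsUp + dsUp) = 0 := by rw [hxa]; exact QOf_eq_zero_of_dOf_neg _ (by omega)
          have hQz : QOf (a - dsUp + dsUp + slotDown i) = 0 := by
            rw [hxa]; exact QOf_eq_zero_of_dOf_neg _ (by rw [dOf_bOfA_slotDown _ hiI]; omega)
          rw [hQx, hQa, hQz]; push_cast; ring
        · have hd1 : dOf (bOfA a) = -1 := by omega
          exact dictPencil_Q_dZero (a - dsUp) hconvx hnnx (by rw [hdxs, hd1]; norm_num) hiI
            (by rw [exk i hiI]; have := hbig hd1; omega)
      rw [hxa] at hI hQ hconvz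
      -- the apex coefficient `b_i(b₀ + 1 − b_i) ≠ 0`
      have hβ : (pencilApex (bOfA (a - dsUp)) i : ℚ) ≠ 0 := by
        have hiN : bOfA a i + 1 ≤ bOfA a 0 := by rcases hi with rfl | rfl | rfl <;> omega
        have h : (1 : ℤ) ≤ (bOfA (a - dsUp) i + 1) * (bOfA (a - dsUp) 0 + 2 - bOfA (a - dsUp) i) :=
          one_le_mul_of_one_le_of_one_le (by rw [exk i hiI]; have := hge1 i hiI; omega)
            (by rw [exk i hiI, ex0]; omega)
        have h' : pencilApex (bOfA (a - dsUp)) i ≠ 0 := by unfold pencilApex; omega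
        exact_mod_cast h'
      -- the two other members have slots `≥ 0` and `d + 1 ≥ −k`
      have hnnz : ∀ j ∈ Icc 1 7, 0 ≤ bOfA (a + slotDown i) j := fun j hj => by
        rw [bOfA_add_slotDown a i hiI j (mem_Icc.1 hj).2]
        have := hge1 j hj
        split_ifs <;> omega
      have hdz : dOf (bOfA (a + slotDown i)) = dOf (bOfA a) + 1 := dOf_bOfA_slotDown _ hiI
      exact shape_of_threeTerm_second hβ hI hQ (ih _ hconvx hnnx (by rw [hdxs]; omega))
        (ih _ hconvz hnnz (by rw [hdz]; omega))
    by_cases hd2 : dOf (bOfA a) ≤ -2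
    · exact main 2 (Or.inl rfl) (fun h => by omega)
    · have hd1 : dOf (bOfA a) = -1 := by omega
      by_cases hb2 : 2 ≤ bOfA a 2
      · exact main 2 (Or.inl rfl) (fun _ => hb2)
      by_cases hb7 : 2 ≤ bOfA a 7
      · exact main 7 (Or.inr (Or.inl rfl)) (fun _ => hb7)
      by_cases hb1 : 2 ≤ bOfA a 1
      · exact main 1 (Or.inr (Or.inr rfl)) (fun _ => hb1)
      -- the special point: `b = (2; 1,…,1)`, i.e. `a = DS`
      have hb0 : bOfA a 0 = 2 := by omega
      have hb1' : bOfA a 1 = 1 := by omega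
      have hb2' : bOfA a 2 = 1 := by omega
      have hb3' : bOfA a 3 = 1 := by omega
      have hb4' : bOfA a 4 = 1 := by omega
      have hb5' : bOfA a 5 = 1 := by omega
      have hb6' : bOfA a 6 = 1 := by omega
      have hb7' : bOfA a 7 = 1 := by omega
      simp only [bOfA] at hb0 hb1' hb2' hb3' hb4' hb5' hb6' hb7'
      have ha : a = dsUp := by
        funext j
        fin_cases j <;> simp [dsUp] <;> omega
      subst ha
      exact shape_dsUp

set_option maxHeartbeats 800000 in
/-- **All convergent points, by induction on the depth of the most negative slot.**  For a convergent `a` with every dual slot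
`≥ −k`, `I(a)` has the shape (4): with no negative slot this is `shape_of_nonneg_slots`; with a negative slot `m` (then
`d ≥ 1` and `Q(a) = 0`) `a` is the BASE of the slot-2 PENCIL `{a, a + DS, a + DS − s₂}`, whose other members have slots
`≥ −k + 1`; the `Q`-side is trivial if some slot is `≤ −2` and ct-1 g24's `dictPencil_Q_of_ghost_base` otherwise. -/
theorem shape_of_slots_ge (k : ℕ) : ∀ a : Fin 8 → ℤ, Converges a → (∀ j ∈ Icc 1 7, -(k : ℤ) ≤ bOfA a j) →
    ∃ Phat P : ℚ, cellularIntegral a =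
      (QOf a : ℝ) * (2 * zetaValue 5 + 4 * zetaValue 3 * zetaValue 2) - 4 * (Phat : ℝ) * zetaValue 2 - 2 * (P : ℝ) := by
  induction k with
  | zero =>
    intro a hconv hge
    exact shape_of_nonneg_slots (dOf (bOfA a)).natAbs a hconv (fun j hj => by have := hge j hj; omega) (by omega)
  | succ k ih =>
    intro a hconv hge
    by_cases hneg : ∃ m ∈ Icc 1 7, bOfA a m < 0
    swap
    · push Not at hneg
      exact shape_of_nonneg_slots (dOf (bOfA a)).natAbs a hconv hneg (by omega)
    obtain ⟨m, hm, hmneg⟩ := hneg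
    obtain ⟨hm1, hm7⟩ := mem_Icc.1 hm
    have hc := (converges_iff_bcoords a).1 hconv
    have hdx := dOf_expand (bOfA a)
    have h2I : (2 : ℕ) ∈ Icc 1 7 := by simp
    have hd1 : 1 ≤ dOf (bOfA a) := by interval_cases m <;> omega
    have hconvy : Converges (a + dsUp) := converges_dsUp hconv
    have hconvz : Converges (a + dsUp + slotDown 2) := converges_dsUp_slotDown hconv h2I
    have hI := cellPencil_wide_2 a hconv hconvy hconvz
    -- coordinates of the two other members
    have ey : ∀ j ∈ Icc 1 7, bOfA (a + dsUp) j = bOfA a j + 1 := fun j hj => bOfA_dsUp_slot a hj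
    have ez := bOfA_dsUp_slotDown a h2I
    have hdy : dOf (bOfA (a + dsUp)) = dOf (bOfA a) - 1 := dOf_bOfA_add_dsUp a
    -- the `Q`-side of the pencil
    have hQa : QOf a = 0 := QOf_eq_zero_of_slot_neg a hm hmneg
    have hQ : (pencilBase (bOfA a) : ℚ) * (QOf a : ℚ) + (pencilApex (bOfA a) 2 : ℚ) * (QOf (a + dsUp) : ℚ) +
        (fanCoeff (bOfA (a + dsUp)) 2 : ℚ) * (QOf (a + dsUp + slotDown 2) : ℚ) = 0 := by
      by_cases hdeep : ∃ m' ∈ Icc 1 7, bOfA a m' ≤ -2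
      · -- a slot `≤ −2`: all three `Q` vanish
        obtain ⟨m', hm', hle2⟩ := hdeep
        obtain ⟨hm'1, hm'7⟩ := mem_Icc.1 hm'
        have hm'2 : m' ≠ 2 := by rintro rfl; omega
        have hQy : QOf (a + dsUp) = 0 := QOf_eq_zero_of_slot_neg _ hm' (by rw [ey m' hm']; omega)
        have hQz : QOf (a + dsUp + slotDown 2) = 0 :=
          QOf_eq_zero_of_slot_neg _ hm' (by rw [ez m' hm'7, if_neg (by omega), if_neg hm'2]; omega)
        rw [hQa, hQy, hQz]; push_cast; ring
      · -- every slot `≥ −1`: the apex `a + DS` is wide, and the relation is the ghost-base law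
        push Not at hdeep
        have hxm : bOfA a m = -1 := by have := hdeep m hm; omega
        have h2m : (2 : ℕ) ≠ m := by rintro rfl; omega
        have hnn_y : ∀ j ∈ Icc 1 7, 0 ≤ bOfA (a + dsUp) j := fun j hj => by
          rw [ey j hj]; have := hdeep j hj; omega
        exact dictPencil_Q_of_ghost_base a h2I hm h2m hxm hconvy hnn_y (by rw [hdy]; omega)
    -- the base coefficient `−(b₂+1)(b₃+1) ≠ 0`
    have hα : (pencilBase (bOfA a) : ℚ) ≠ 0 := by
      have h : (1 : ℤ) ≤ (bOfA a 2 + 1) * (bOfA a 3 + 1) := one_le_mul_of_one_le_of_one_le (by omega) (by omega)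
      have h' : pencilBase (bOfA a) ≠ 0 := by unfold pencilBase; omega
      exact_mod_cast h'
    -- the two other members have slots `≥ −k`
    have hge_y : ∀ j ∈ Icc 1 7, -(k : ℤ) ≤ bOfA (a + dsUp) j := fun j hj => by
      rw [ey j hj]; have := hge j hj; push_cast at this; omega
    have hge_z : ∀ j ∈ Icc 1 7, -(k : ℤ) ≤ bOfA (a + dsUp + slotDown 2) j := fun j hj => by
      obtain ⟨hj1, hj7⟩ := mem_Icc.1 hj
      rw [ez j hj7, if_neg (by omega)]
      have := hge j hj; push_cast at this
      split_ifs with h2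
      · have := hc.1; omega
      · omega
    exact shape_of_threeTerm_first hα hI hQ (ih _ hconvy hge_y) (ih _ hconvz hge_z)

/-- **BROWN–ZUDILIN's DECOMPOSITION (4) WITH (17) ON THE WHOLE CONVERGENCE CONE** — the named Literature fact
`BrownZudilin2022.decomposition` DISCHARGED: for every convergent `a` there are `P̂, P ∈ ℚ` with
`I(a) = Q(a)·(2ζ(5) + 4ζ(3)ζ(2)) − 4P̂·ζ(2) − 2P`. [cite: BrownZudilin2022, Sect. 1, eq. (4); Sect. 5, eq. (17)] -/
theorem decomposition_holds : decomposition := fun a hconv =>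
  shape_of_slots_ge ((bOfA a 1).natAbs + (bOfA a 2).natAbs + (bOfA a 3).natAbs + (bOfA a 4).natAbs + (bOfA a 5).natAbs +
      (bOfA a 6).natAbs + (bOfA a 7).natAbs) a hconv (fun j hj => by
    obtain ⟨hj1, hj7⟩ := mem_Icc.1 hj
    interval_cases j <;> omega)

end Summit.KontsevichZagierPeriods.Zeta5Search.DecompositionWholeCone

end
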